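import Literature.Barriers.Parity.SiegelZeroDichotomyPairHLMoebiusSlot
import Literature.Barriers.Parity.SiegelZeroDichotomyPairHLMainTermSums
import Literature.Barriers.Parity.SiegelZeroDichotomyPairHLSixSlotBox
import HarnessLib

/-!
# Tao–Teräväinen 2022, §8 (`k = 2`): the size of the model factor `∏_j ∏_{p<N} (1 − p^{-s(τ_{j,0})})`

Topic `Literature/Barriers/Parity`, sub-namespace `TaoTeravainen`; the model bound `MB` of the §8 assembly
(`SiegelZeroDichotomyPairHLProp81Kernel.lean`) in the proof DAG of
`Literature.Barriers.Parity.TaoTeravainen2021_prop72_81_pair` (T. Tao, J. Teräväinen, *The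
Hardy–Littlewood–Chowla conjecture in the presence of a Siegel zero*, J. London Math. Soc. (2) 106 (2022),
arXiv:2109.06291), §3.1 (3.2) "`∏_p (1 − 1/p^s) = 1/ζ(s) = (1 + O(|s−1|))(s−1)`" as used in §8 (8.25):
from `MainTerm.norm_prod_one_sub_cpow_le` (the elementary upper bound `≪ σ²/X` for `Re(s−1) = 1/X`,
`|s − 1| ≤ σ/X`) we get, PROVED:

* `zetaSlotS_eq`, `norm_eulerTrunc_le_sq` — `‖∏_{p<N}(1 − p^{-s(τ)})‖ ≤ e^{c₀}(1 + 2πX|τ|)²/X` for `N > e^X`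
  (`c₀ = log log 2 + 6/log 2 + 77`);
* **`norm_prod_eulerTrunc_le`** — `‖∏_j ∏_{p<N}(1 − p^{-s(τ_{j,0})})‖ ≤ (2π)⁴ e^{2c₀} X⁻² ∏_j (1 + X|τ_{j,0}|)²`.
  [cite: TaoTeravainen2021, §3.1 (3.2) and §8 (8.25)]
-/

noncomputable section

open Real Finset Complex

namespace Literature.Barriers.Parity

namespace TaoTeravainen

/-- The constant `c₀ = log log 2 + 6/log 2 + 77` of `MainTerm.norm_prod_one_sub_cpow_le` at `C₀ = 2`.
[folklore] -/
def modelConst : ℝ := Real.log (Real.log 2) + 6 / Real.log 2 + 77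

/-- `s(τ) = 1 + z(τ)` with `z(τ) = 1/X − 2πiτ`, `Re z = 1/X`, `‖z‖ ≤ (1 + 2πX|τ|)/X` (`X > 0`). [folklore] -/
theorem zetaSlotS_eq (X τ : ℝ) (hX : 0 < X) :
    zetaSlotS X τ = 1 + (((X⁻¹ : ℝ) : ℂ) - 2 * π * τ * I) ∧ (((X⁻¹ : ℝ) : ℂ) - 2 * π * τ * I).re = 1 / X ∧
      ‖((X⁻¹ : ℝ) : ℂ) - 2 * π * τ * I‖ ≤ (1 + 2 * π * X * |τ|) / X := by
  refine ⟨by unfold zetaSlotS; push_cast; ring, by simp [one_div], ?_⟩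
  calc ‖((X⁻¹ : ℝ) : ℂ) - 2 * π * τ * I‖ ≤ ‖((X⁻¹ : ℝ) : ℂ)‖ + ‖(2 : ℂ) * π * τ * I‖ := norm_sub_le _ _
    _ = X⁻¹ + 2 * π * |τ| := by
        rw [Complex.norm_real, Real.norm_eq_abs, abs_of_pos (inv_pos.mpr hX), norm_mul, norm_mul, norm_mul,
          Complex.norm_I, mul_one, Complex.norm_real, Complex.norm_real, Real.norm_eq_abs, Real.norm_eq_abs,
          abs_of_pos Real.pi_pos, Complex.norm_two]
    _ = (1 + 2 * π * X * |τ|) / X := by field_simp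

/-- **One slot**: `‖∏_{p<N}(1 − p^{-s(τ)})‖ ≤ e^{c₀} (1 + 2πX|τ|)²/X` for `X ≥ 2` and `e^X < N`.
[cite: TaoTeravainen2021, §3.1 (3.2)] -/
theorem norm_eulerTrunc_le_sq {X : ℝ} (hX : 2 ≤ X) {N : ℕ} (hN : Real.exp X < N) (τ : ℝ) :
    ‖eulerTrunc N (zetaSlotS X τ)‖ ≤ Real.exp modelConst * (1 + 2 * π * X * |τ|) ^ 2 / X := by
  have hX0 : 0 < X := by linarith
  obtain ⟨hs, hre, hnorm⟩ := zetaSlotS_eq X τ hX0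
  have hP : ∀ p ∈ Nat.primesBelow N, p.Prime := fun p hp => Nat.prime_of_mem_primesBelow hp
  have hPsup : ∀ p : ℕ, p.Prime → 2 ≤ p → (p : ℝ) ≤ Real.exp X → p ∈ Nat.primesBelow N := by
    intro p hp _ hpX
    exact Nat.mem_primesBelow.mpr ⟨by exact_mod_cast lt_of_le_of_lt hpX hN, hp⟩
  have hσ : (1 : ℝ) ≤ 1 + 2 * π * X * |τ| := by
    have : 0 ≤ 2 * π * X * |τ| := by positivity
    linarith
  have h := MainTerm.norm_prod_one_sub_cpow_le hP (le_refl 2) hX hσ (by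
      have := Real.add_one_le_exp X; norm_num; linarith) hPsup hre hnorm
  have hfilter : (Nat.primesBelow N).filter (fun p : ℕ => 2 ≤ p) = Nat.primesBelow N :=
    filter_true_of_mem fun p hp => (hP p hp).two_le
  rw [hfilter] at h
  have heq : eulerTrunc N (zetaSlotS X τ) =
      ∏ p ∈ Nat.primesBelow N, (1 - (p : ℂ) ^ (-(1 + (((X⁻¹ : ℝ) : ℂ) - 2 * π * τ * I)))) := by
    unfold eulerTrunc; rw [hs]
  rw [heq]
  unfold modelConst
  simp only [Nat.cast_ofNat] at h
  exact h

/-- **The model bound `MB`**: `‖∏_j ∏_{p<N}(1 − p^{-s(τ_{j,0})})‖ ≤ (2π)⁴ e^{2c₀} X⁻² ∏_j (1 + X|τ_{j,0}|)²`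
(`X ≥ 2`, `e^X < N`). [cite: TaoTeravainen2021, §3.1 (3.2) and §8 (8.25)] -/
theorem norm_prod_eulerTrunc_le {X : ℝ} (hX : 2 ≤ X) {N : ℕ} (hN : Real.exp X < N) (τ : Slot → ℝ) :
    ‖∏ j : Fin 2, eulerTrunc N (zetaSlotS X (τ (j, 0)))‖ ≤
      ((2 * π) ^ 4 * Real.exp modelConst ^ 2) * (X ^ 2)⁻¹ * ∏ j : Fin 2, (1 + X * |τ (j, 0)|) ^ 2 := by
  have hX0 : 0 < X := by linarith
  have hslot : ∀ t : ℝ, ‖eulerTrunc N (zetaSlotS X t)‖ ≤ (2 * π) ^ 2 * Real.exp modelConst * (1 + X * |t|) ^ 2 / X := by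
    intro t
    refine (norm_eulerTrunc_le_sq hX hN t).trans ?_
    rw [div_le_div_iff_of_pos_right hX0]
    have h1 : (1 + 2 * π * X * |t|) ≤ 2 * π * (1 + X * |t|) := by
      have := Real.pi_gt_three; have := abs_nonneg t; nlinarith
    have h0 : 0 ≤ 1 + 2 * π * X * |t| := by have := abs_nonneg t; positivity
    calc Real.exp modelConst * (1 + 2 * π * X * |t|) ^ 2 ≤ Real.exp modelConst * (2 * π * (1 + X * |t|)) ^ 2 := by
          gcongr
      _ = (2 * π) ^ 2 * Real.exp modelConst * (1 + X * |t|) ^ 2 := by ring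
  rw [Fin.prod_univ_two, Fin.prod_univ_two, norm_mul]
  calc ‖eulerTrunc N (zetaSlotS X (τ (0, 0)))‖ * ‖eulerTrunc N (zetaSlotS X (τ (1, 0)))‖
      ≤ ((2 * π) ^ 2 * Real.exp modelConst * (1 + X * |τ (0, 0)|) ^ 2 / X) *
          ((2 * π) ^ 2 * Real.exp modelConst * (1 + X * |τ (1, 0)|) ^ 2 / X) :=
        mul_le_mul (hslot _) (hslot _) (norm_nonneg _) (by positivity)
    _ = ((2 * π) ^ 4 * Real.exp modelConst ^ 2) * (X ^ 2)⁻¹ * ((1 + X * |τ (0, 0)|) ^ 2 * (1 + X * |τ (1, 0)|) ^ 2) := by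
        field_simp

end TaoTeravainen

end Literature.Barriers.Parity
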